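import Literature.NumberTheory.Sieve.FriedlanderIwaniecPrimesWeylHarmonics
import Literature.NumberTheory.Sieve.PolynomialCongruencesProofs
import Literature.NumberTheory.Sieve.AletheiaZomleferFukshanskyGarcia2020Applications
import Literature.NumberTheory.Sieve.DivisorBound
import HarnessLib

/-!
# Friedlander–Iwaniec, *The polynomial `X² + Y⁴` captures its primes*, Lemma 3.3 (proof)

Family `parity`, statement parity.S17. Source: J. Friedlander, H. Iwaniec, Ann. of Math. (2) 148
(1998), 945–1040 [FriedlanderIwaniecAnnals1998] (= arXiv:math/9811185), §3, Lemma 3.3 and its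
proof (p. 956 of the journal = p. 11 of the arXiv version):

> LEMMA 3.3. For any complex numbers `ξ(k, ℓ)` we have
> `∑_{d ≤ D} |∑_{0<k≤K} ∑_{0<ℓ≤L} ξ(k, ℓ) ρ(k, ℓ; d)| ≪ (D + √(DKL)) (DKL)^ε ‖ξ‖`
> where `‖ξ‖` denotes the `ℓ₂`-norm of `ξ = (ξ(k, ℓ))` … and the implied constant depends only
> on `ε`.

Here `ρ(k, ℓ; d) = ∑_{ν² + ℓ² ≡ 0 (mod d)} e(νk/d)` is the Weyl harmonic (3.7) (`fiWeyl` of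
`FriedlanderIwaniecPrimesWeylHarmonics`). Lemma 3.3 is the input of FI Lemma 3.1 (the named fact
`FriedlanderIwaniec1998_lemma31` of `FriedlanderIwaniecPrimesMainTerm`, on which Proposition 3.5 and
hence the level-of-distribution hypothesis (2.9) of Theorem 1 rest). This file PROVES it:

* **`fi_lemma33`** (as printed): for every `ε > 0` there is `c(ε)` with
  `∑_{d ≤ D} |∑∑ ξ(k,ℓ) ρ(k,ℓ;d)| ≤ c(ε) (DKL)^ε (D + √(DKL)) ‖ξ‖` for all `D, K, L` and `ξ`;
* **`fi_lemma33_core`** (the explicit form behind it): if `ρ(n) ≤ C τ(n)` (`n ≥ 1`) and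
  `τ(n) ≤ T` for `1 ≤ n ≤ DKL²`, then the left side is
  `≤ 270 · C T³ (1 + log D)^{1/2} √D √(D + KL) ‖ξ‖`.

## The argument (FI §3, made effective)

FI: "letting `(d, ℓ²) = γδ²` with `γ` squarefree so `d = γδ²d'`, `ℓ = γδℓ'`, one shows that
(3.9) `ρ(k, ℓ; d) = δρ(k'ℓ', 1; d')` … By this we obtain
`∑_{d≤D} |∑∑ ξ ρ| ≤ ∑_γ ∑_δ ∑_{d ≤ D/(γδ²)} δ |∑_{k ≤ K/δ, ℓ ≤ L/(γδ), (ℓ,d)=1} ξ(δk, γδℓ) ρ(kℓ, 1; d)|`.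
Ignoring the condition `(ℓ, d) = 1` we would get the bound of Lemma 3.3 by applying (3.6) directly.
However this co-primality condition can be inserted at no extra cost by Möbius inversion."

1. *Fibres* (`sum_Icc_eq_sum_divisors_fiber`, `sum_Icc_sum_divisors_eq`): group `ℓ` by
   `g = (d, ℓ²) ∣ d` and write `d = gd'`; for `g = γδ²` (`Nat.sq_mul_squarefree_of_pos`) the fibre
   is `ℓ = γδℓ'`, `(d', γℓ') = 1` (`gcd_eq_mul_sq_iff`), and (3.9) (`fiWeyl_eq_of_factorization`)
   gives `fiber_sum_eq` / `norm_fiber_sum_le`: the fibre contributes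
   `δ |∑_{ℓ' ≤ L/(γδ), (d',ℓ')=1} ∑_{k' ≤ K/δ} ξ(δk', γδℓ') ρ(k'ℓ', 1; d')|` (the condition
   `(d', γ) = 1` only restricts `d'`).
2. *Möbius* (`coprime_sum_eq_sum_divisors`): `[(d',ℓ')=1] = ∑_{η ∣ d', η ∣ ℓ'} μ(η)`, so the
   reduced form at `d'` is `∑_{η ∣ d'} μ(η) W_η(d')`, `W_η(d') = ∑_{ℓ''≤L'/η} ∑_{k'} ξ'(k', ηℓ'') ρ(k'ηℓ'', 1; d')`.
3. *The moduli `d' = ηd₁`* (`norm_weylSum_le`): since `e(ω·ηm/(ηd₁)) = e(ωm/d₁)` depends on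
   `ω mod d₁ ∈ {roots mod d₁}`, `|W_η(ηd₁)| ≤ ρ(ηd₁) ∑_{λ² + 1 ≡ 0 (d₁)} |∑_{m ≤ K'L'/η} b_η(m) e(λm/d₁)|`
   with `b_η(m) = ∑_{k'ℓ''=m} ξ'(k', ηℓ'')`; the multiplicity is bounded crudely by
   `ρ(ηd₁) ≤ C τ(ηd₁)` (Hooley's bound for `X² + 1`, `exists_fiRho_le_mul_card_divisors`, from the
   tree's `exists_polyRootCountMod_le_mul_pow_card_primeFactors`). (FI do not spell this step out.)
4. *(3.6)* (`sum_sum_fiRoots_norm_le` = the tree's `sum_roots_norm_le` of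
   `FriedlanderIwaniecPrimesRootSpacing`) over `d₁ ≤ D'/η` with length `K'L'/η`:
   `≤ 190 η⁻¹ √D' √(D' + K'L') ‖b_η‖`, and `‖b_η‖² ≤ T ∑_{k', ℓ''} |ξ'(k', ηℓ'')|²`
   (`sum_norm_prodCoeff_sq_le`, Cauchy); then `∑_η η⁻¹ (…)^{1/2} ≤ (∑η⁻²)^{1/2} (T‖ξ'‖²)^{1/2}`
   (`sum_norm_coprime_sum_le`: the reduced forms are `≤ 190√2 C T² √D' √(D'+K'L') ‖ξ'‖`).
5. *Summation over `g`* (`fi_lemma33_core`): with `D' = D/g`, `K'L' ≤ KL/g`, `δ/g = 1/(γδ) ≤ g^{-1/2}`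
   and `‖ξ'_g‖² ≤ ∑_{k, g ∣ ℓ²} |ξ(k,ℓ)|²`, Cauchy's inequality in `g`, `∑_{g≤D} g⁻¹ ≤ 1 + log D` and
   `#{g ≤ D : g ∣ ℓ²} ≤ τ(ℓ²) ≤ T` give `270 C T³ (1 + log D)^{1/2} √D √(D+KL) ‖ξ‖`;
   `fi_lemma33` absorbs `T³ (1 + log D)^{1/2}` into `(DKL)^ε` by the divisor bound
   (`exists_card_divisors_le_mul_rpow`) and `log D ≤ D^{ε'}/ε'`.

## References

* J. Friedlander, H. Iwaniec, *The polynomial `X² + Y⁴` captures its primes*, Ann. of Math. (2)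
  148 (1998), 945–1040, §3, Lemma 3.3, (3.6)–(3.9). [cite: FriedlanderIwaniecAnnals1998, Lemma 3.3]
* C. Hooley, *On the number of divisors of quadratic polynomials*, Acta Math. 110 (1963); the
  bound `ρ_f(n) ≤ C (deg f)^{ω(n)}` as in the tree's `PolynomialCongruencesProofs` (Hooley 1964,
  Lemma 4).

## Mathlib / tree search

Tree: `fiRoots`, `fiWeyl`, `gcd_eq_mul_sq_iff`, `fiWeyl_eq_of_factorization`, `card_fiRoots_one`
(`FriedlanderIwaniecPrimesWeylHarmonics`); `sum_roots_norm_le` (`FriedlanderIwaniecPrimesRootSpacing`);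
`fiRho` (`FriedlanderIwaniecPrimes`); `exists_polyRootCountMod_le_mul_pow_card_primeFactors`
(`PolynomialCongruencesProofs`), `irreducible_X_sq_add_one_int`
(`AletheiaZomleferFukshanskyGarcia2020Applications`), `exists_card_divisors_le_mul_rpow`
(`DivisorBound`); `LargeSieve.e`, `e_add_int` (`LargeSieveInequality`). Mathlib:
`Nat.sq_mul_squarefree_of_pos`, `ArithmeticFunction.moebius_mul_coe_zeta`,
`Finset.sum_fiberwise_of_maps_to`, `Real.sum_mul_le_sqrt_mul_sqrt`, `sq_sum_le_card_mul_sum_sq`,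
`sum_Ioc_inv_sq_le_sub`, `harmonic_le_one_add_log`, `Real.log_le_rpow_div`, `Nat.card_divisors`.
`lean search 'lemma33|fi_lemma33'`: nothing before this file. No definitions are introduced.
-/

noncomputable section

open Finset Real Complex
open scoped FourierTransform

namespace Literature.NumberTheory.Sieve.FriedlanderIwaniecPrimes

open LargeSieve Polynomial
open scoped ArithmeticFunction.Moebius

/-! ### Bookkeeping: multiples, divisors, fibres -/

/-- The multiples of `q ≥ 1` in `[1, N]` are `q·[1, N/q]`. [folklore] -/
theorem filter_dvd_Icc_eq_image_mul {q : ℕ} (hq : 0 < q) (N : ℕ) :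
    (Icc 1 N).filter (fun n => q ∣ n) = (Icc 1 (N / q)).image (fun m => q * m) := by
  ext n
  simp only [mem_filter, mem_Icc, mem_image]
  constructor
  · rintro ⟨⟨h1, h2⟩, m, rfl⟩
    refine ⟨m, ⟨?_, ?_⟩, rfl⟩
    · rcases Nat.eq_zero_or_pos m with rfl | hm
      · simp at h1
      · exact hm
    · exact (Nat.le_div_iff_mul_le hq).mpr (by rwa [mul_comm] at h2)
  · rintro ⟨m, ⟨h1, h2⟩, rfl⟩
    refine ⟨⟨Nat.mul_pos hq h1, ?_⟩, dvd_mul_right q m⟩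
    have := (Nat.le_div_iff_mul_le hq).mp h2
    rwa [mul_comm] at this

/-- Summing over the multiples of `q ≥ 1` in `[1, N]`. [folklore] -/
theorem sum_filter_dvd_Icc {M : Type*} [AddCommMonoid M] {q : ℕ} (hq : 0 < q) (N : ℕ)
    (f : ℕ → M) :
    ∑ n ∈ (Icc 1 N).filter (fun n => q ∣ n), f n = ∑ m ∈ Icc 1 (N / q), f (q * m) := by
  rw [filter_dvd_Icc_eq_image_mul hq, sum_image]
  intro a _ b _ h
  exact Nat.eq_of_mul_eq_mul_left hq h

/-- `∑_{d ≤ D} ∑_{g ∣ d} X(g, d) = ∑_{g ≤ D} ∑_{d' ≤ D/g} X(g, gd')`. [folklore] -/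
theorem sum_Icc_sum_divisors_eq {M : Type*} [AddCommMonoid M] (D : ℕ) (X : ℕ → ℕ → M) :
    ∑ d ∈ Icc 1 D, ∑ g ∈ d.divisors, X g d =
      ∑ g ∈ Icc 1 D, ∑ d' ∈ Icc 1 (D / g), X g (g * d') := by
  have h1 : ∀ d ∈ Icc 1 D, d.divisors = (Icc 1 D).filter (fun g => g ∣ d) := by
    intro d hd
    rw [mem_Icc] at hd
    ext g
    simp only [Nat.mem_divisors, mem_filter, mem_Icc]
    constructor
    · rintro ⟨hgd, -⟩
      exact ⟨⟨Nat.pos_of_dvd_of_pos hgd (by omega), (Nat.le_of_dvd (by omega) hgd).trans hd.2⟩,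
        hgd⟩
    · rintro ⟨-, hgd⟩
      exact ⟨hgd, by omega⟩
  rw [sum_congr rfl fun d hd => by rw [h1 d hd]]
  simp_rw [sum_filter]
  rw [sum_comm]
  refine sum_congr rfl fun g hg => ?_
  rw [← sum_filter, sum_filter_dvd_Icc (by rw [mem_Icc] at hg; omega)]

/-- Grouping `ℓ ≤ L` according to the value of `(d, ℓ²)`, a divisor of `d ≠ 0`. [folklore] -/
theorem sum_Icc_eq_sum_divisors_fiber {M : Type*} [AddCommMonoid M] {d : ℕ} (hd : d ≠ 0)
    (L : ℕ) (F : ℕ → M) :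
    ∑ ℓ ∈ Icc 1 L, F ℓ =
      ∑ g ∈ d.divisors, ∑ ℓ ∈ (Icc 1 L).filter (fun ℓ => Nat.gcd d (ℓ ^ 2) = g), F ℓ := by
  rw [sum_fiberwise_of_maps_to (g := fun ℓ => Nat.gcd d (ℓ ^ 2)) (t := d.divisors)]
  intro ℓ _
  exact Nat.mem_divisors.mpr ⟨Nat.gcd_dvd_left _ _, hd⟩

/-- The number of `η ∈ [1, D]` dividing `ℓ ≠ 0` is at most `τ(ℓ)`. [folklore] -/
theorem card_filter_dvd_le_card_divisors (D : ℕ) {ℓ : ℕ} (hℓ : ℓ ≠ 0) :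
    #((Icc 1 D).filter (fun η => η ∣ ℓ)) ≤ #ℓ.divisors :=
  card_le_card fun _ hη => Nat.mem_divisors.mpr ⟨(mem_filter.mp hη).2, hℓ⟩

/-- `∑_{η ≤ D'} ∑_{ℓ'' ≤ L'/η} f(ηℓ'') ≤ T ∑_{ℓ ≤ L'} f(ℓ)` for `f ≥ 0` when `τ(ℓ) ≤ T` on `[1, L']`
(each `ℓ` is hit once for every divisor `η ≤ D'`). [folklore] -/
theorem sum_sum_div_le {T : ℕ} (D' L' : ℕ) (f : ℕ → ℝ) (hf : ∀ ℓ, 0 ≤ f ℓ)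
    (hT : ∀ ℓ, ℓ ≠ 0 → ℓ ≤ L' → #ℓ.divisors ≤ T) :
    ∑ η ∈ Icc 1 D', ∑ ℓ'' ∈ Icc 1 (L' / η), f (η * ℓ'') ≤ T * ∑ ℓ ∈ Icc 1 L', f ℓ := by
  calc ∑ η ∈ Icc 1 D', ∑ ℓ'' ∈ Icc 1 (L' / η), f (η * ℓ'')
      = ∑ η ∈ Icc 1 D', ∑ ℓ ∈ (Icc 1 L').filter (fun ℓ => η ∣ ℓ), f ℓ := by
        refine sum_congr rfl fun η hη => ?_
        rw [sum_filter_dvd_Icc (by rw [mem_Icc] at hη; omega)]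
    _ = ∑ ℓ ∈ Icc 1 L', ∑ η ∈ (Icc 1 D').filter (fun η => η ∣ ℓ), f ℓ := by
        simp_rw [sum_filter]
        rw [sum_comm]
    _ = ∑ ℓ ∈ Icc 1 L', (#((Icc 1 D').filter (fun η => η ∣ ℓ)) : ℝ) * f ℓ := by
        simp_rw [sum_const, nsmul_eq_mul]
    _ ≤ ∑ ℓ ∈ Icc 1 L', (T : ℝ) * f ℓ := by
        refine sum_le_sum fun ℓ hℓ => mul_le_mul_of_nonneg_right ?_ (hf ℓ)
        rw [mem_Icc] at hℓ
        exact_mod_cast (card_filter_dvd_le_card_divisors D' (by omega)).trans (hT ℓ (by omega) hℓ.2)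
    _ = T * ∑ ℓ ∈ Icc 1 L', f ℓ := (mul_sum _ _ _).symm

/-- `∑_{n ≤ N} n⁻² ≤ 2`. [folklore] -/
theorem sum_Icc_inv_sq_le_two (N : ℕ) : ∑ n ∈ Icc 1 N, ((n : ℝ) ^ 2)⁻¹ ≤ 2 := by
  rcases Nat.eq_zero_or_pos N with rfl | hN
  · simp
  · have h1 : Icc 1 N = insert 1 (Ioc 1 N) := by
      ext n; simp only [mem_Icc, mem_insert, mem_Ioc]; omega
    rw [h1, sum_insert (by simp)]
    have h2 := sum_Ioc_inv_sq_le_sub (α := ℝ) one_ne_zero hN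
    have h3 : (0 : ℝ) ≤ (N : ℝ)⁻¹ := by positivity
    norm_num at h2 ⊢
    linarith

/-! ### `ρ(n) ≤ C τ(n)` (Hooley's bound for `X² + 1`) -/

/-- `2^{ω(n)} ≤ τ(n)` for `n ≠ 0`. [folklore] -/
theorem two_pow_card_primeFactors_le_card_divisors {n : ℕ} (hn : n ≠ 0) :
    2 ^ n.primeFactors.card ≤ #n.divisors := by
  rw [Nat.card_divisors hn]
  refine pow_card_le_prod _ _ _ fun p hp => ?_
  have := Nat.mem_primeFactors.mp hp
  have hpos : 0 < n.factorization p := this.1.factorization_pos_of_dvd hn this.2.1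
  omega

/-- **`ρ(n) ≪ τ(n)`**: there is an absolute `C ≥ 1` with `ρ(n) = #{ν mod n : ν² + 1 ≡ 0} ≤ C τ(n)`
for all `n ≥ 1` — Hooley's bound `ρ_f(n) ≤ C(f) (deg f)^{ω(n)}` (tree:
`exists_polyRootCountMod_le_mul_pow_card_primeFactors`) for `f = X² + 1`, and `2^{ω(n)} ≤ τ(n)`.
[folklore] -/
theorem exists_fiRho_le_mul_card_divisors :
    ∃ C : ℕ, 1 ≤ C ∧ ∀ n : ℕ, n ≠ 0 → fiRho n ≤ C * #n.divisors := by
  have hdeg : (X ^ 2 + 1 : ℤ[X]).natDegree = 2 := by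
    simpa using natDegree_X_pow_add_C (n := 2) (r := (1 : ℤ))
  obtain ⟨C, hC1, hC⟩ := exists_polyRootCountMod_le_mul_pow_card_primeFactors
    irreducible_X_sq_add_one_int (by rw [hdeg]; norm_num)
  refine ⟨C, hC1, fun n hn => ?_⟩
  have h1 : fiRho n = polyRootCountMod ![(X ^ 2 + 1 : ℤ[X])] n := by
    unfold fiRho polyRootCountMod
    congr 1
    ext ν
    simp only [mem_filter, mem_range, Fin.prod_univ_one, Matrix.cons_val_fin_one, eval_add,
      eval_pow, eval_X, eval_one, and_congr_right_iff]
    intro _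
    rw [show ((ν : ℤ) ^ 2 + 1 : ℤ) = ((ν ^ 2 + 1 : ℕ) : ℤ) by push_cast; ring,
      Int.natCast_dvd_natCast]
  rw [h1]
  refine (hC n).trans ?_
  rw [hdeg]
  exact Nat.mul_le_mul_left C (two_pow_card_primeFactors_le_card_divisors hn)

/-! ### The fibre `(d, ℓ²) = γδ²` and the reduction (3.9) -/

/-- **The contribution of the fibre `(d, ℓ²) = γδ²`.** For `d = γδ²d'` (`γ` squarefree,
`γ, δ, d' ≥ 1`), by `gcd_eq_mul_sq_iff` and (3.9) (`fiWeyl_eq_of_factorization`):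
`∑_{ℓ ≤ L, (d,ℓ²) = γδ²} ∑_{k ≤ K} ξ(k,ℓ) ρ(k,ℓ;d)
  = δ ∑_{ℓ' ≤ L/(γδ), (d', γℓ') = 1} ∑_{k' ≤ K/δ} ξ(δk', γδℓ') ρ(k'ℓ', 1; d')`.
[cite: FriedlanderIwaniecAnnals1998, §3, proof of Lemma 3.3] -/
theorem fiber_sum_eq {γ δ d' : ℕ} (hγ : Squarefree γ) (hγ0 : 0 < γ) (hδ : 0 < δ) (hd' : 0 < d')
    (K L : ℕ) (ξ : ℕ → ℕ → ℂ) :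
    ∑ ℓ ∈ (Icc 1 L).filter (fun ℓ => Nat.gcd (γ * δ ^ 2 * d') (ℓ ^ 2) = γ * δ ^ 2),
        ∑ k ∈ Icc 1 K, ξ k ℓ * fiWeyl k ℓ (γ * δ ^ 2 * d') =
      (δ : ℂ) * ∑ ℓ' ∈ (Icc 1 (L / (γ * δ))).filter (fun ℓ' => Nat.Coprime d' (γ * ℓ')),
        ∑ k' ∈ Icc 1 (K / δ), ξ (δ * k') (γ * δ * ℓ') * fiWeyl (k' * ℓ') 1 d' := by
  have hγδ0 : 0 < γ * δ := Nat.mul_pos hγ0 hδ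
  -- the fibre is the image of `ℓ' ↦ γδℓ'`
  have hfib : (Icc 1 L).filter (fun ℓ => Nat.gcd (γ * δ ^ 2 * d') (ℓ ^ 2) = γ * δ ^ 2) =
      ((Icc 1 (L / (γ * δ))).filter (fun ℓ' => Nat.Coprime d' (γ * ℓ'))).image
        (fun ℓ' => γ * δ * ℓ') := by
    ext ℓ
    simp only [mem_filter, mem_Icc, mem_image, gcd_eq_mul_sq_iff hγ hγ0 hδ]
    constructor
    · rintro ⟨⟨h1, h2⟩, ⟨ℓ', rfl⟩, hcop⟩
      rw [Nat.mul_div_cancel_left _ hγδ0] at hcop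
      refine ⟨ℓ', ⟨⟨?_, ?_⟩, hcop⟩, rfl⟩
      · rcases Nat.eq_zero_or_pos ℓ' with rfl | h
        · simp at h1
        · exact h
      · exact (Nat.le_div_iff_mul_le hγδ0).mpr (by rwa [mul_comm] at h2)
    · rintro ⟨ℓ', ⟨⟨h1, h2⟩, hcop⟩, rfl⟩
      refine ⟨⟨Nat.mul_pos hγδ0 h1, ?_⟩, dvd_mul_right _ _, ?_⟩
      · have := (Nat.le_div_iff_mul_le hγδ0).mp h2
        rwa [mul_comm] at this
      · rwa [Nat.mul_div_cancel_left _ hγδ0]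
  rw [hfib, sum_image fun a _ b _ h => Nat.eq_of_mul_eq_mul_left hγδ0 h, mul_sum]
  refine sum_congr rfl fun ℓ' hℓ' => ?_
  obtain ⟨-, hcop⟩ := mem_filter.mp hℓ'
  have hcopγ : Nat.Coprime d' γ := Nat.Coprime.coprime_dvd_right (dvd_mul_right γ ℓ') hcop
  have hcopℓ : Nat.Coprime d' ℓ' := Nat.Coprime.coprime_dvd_right (dvd_mul_left ℓ' γ) hcop
  simp_rw [fiWeyl_eq_of_factorization hγ hγ0 hδ hd' hcopγ hcopℓ, mul_ite, mul_zero]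
  rw [← sum_filter, sum_filter_dvd_Icc hδ, mul_sum]
  refine sum_congr rfl fun k' _ => ?_
  rw [Nat.mul_div_cancel_left k' hδ]
  ring

/-- The fibre contribution in absolute value: the coprimality with `γ` only restricts `d'`, so
`|∑_{(d,ℓ²)=γδ²} ∑_k ξ ρ| ≤ δ |∑_{ℓ' ≤ L/(γδ), (d',ℓ')=1} ∑_{k' ≤ K/δ} ξ(δk', γδℓ') ρ(k'ℓ', 1; d')|`.
[cite: FriedlanderIwaniecAnnals1998, §3, proof of Lemma 3.3] -/
theorem norm_fiber_sum_le {γ δ d' : ℕ} (hγ : Squarefree γ) (hγ0 : 0 < γ) (hδ : 0 < δ)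
    (hd' : 0 < d') (K L : ℕ) (ξ : ℕ → ℕ → ℂ) :
    ‖∑ ℓ ∈ (Icc 1 L).filter (fun ℓ => Nat.gcd (γ * δ ^ 2 * d') (ℓ ^ 2) = γ * δ ^ 2),
        ∑ k ∈ Icc 1 K, ξ k ℓ * fiWeyl k ℓ (γ * δ ^ 2 * d')‖ ≤
      δ * ‖∑ ℓ' ∈ (Icc 1 (L / (γ * δ))).filter (fun ℓ' => Nat.Coprime d' ℓ'),
        ∑ k' ∈ Icc 1 (K / δ), ξ (δ * k') (γ * δ * ℓ') * fiWeyl (k' * ℓ') 1 d'‖ := by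
  rw [fiber_sum_eq hγ hγ0 hδ hd', norm_mul, Complex.norm_natCast]
  refine mul_le_mul_of_nonneg_left ?_ (Nat.cast_nonneg _)
  by_cases hc : Nat.Coprime d' γ
  · rw [filter_congr (p := fun ℓ' => Nat.Coprime d' (γ * ℓ')) (q := fun ℓ' => Nat.Coprime d' ℓ')
      fun ℓ' _ => ⟨fun h => Nat.Coprime.coprime_dvd_right (dvd_mul_left ℓ' γ) h,
        fun h => Nat.Coprime.mul_right hc h⟩]
  · have hempty : (Icc 1 (L / (γ * δ))).filter (fun ℓ' => Nat.Coprime d' (γ * ℓ')) = ∅ := by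
      refine filter_false_of_mem fun ℓ' _ h => hc ?_
      exact Nat.Coprime.coprime_dvd_right (dvd_mul_right γ ℓ') h
    rw [hempty, sum_empty, norm_zero]
    exact norm_nonneg _

/-! ### Möbius inversion for the condition `(d', ℓ') = 1` -/

/-- `∑_{η ∣ n} μ(η) = [n = 1]` in `ℂ`. [folklore] -/
theorem sum_divisors_moebius_eq_ite (n : ℕ) :
    ∑ η ∈ n.divisors, (μ η : ℂ) = if n = 1 then 1 else 0 := by
  have h := congrArg (fun f : ArithmeticFunction ℤ => f n) ArithmeticFunction.moebius_mul_coe_zeta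
  simp only [ArithmeticFunction.coe_mul_zeta_apply, ArithmeticFunction.one_apply] at h
  have h' : (∑ η ∈ n.divisors, (μ η : ℂ)) = ((∑ η ∈ n.divisors, μ η : ℤ) : ℂ) := by push_cast; rfl
  rw [h', h]
  split_ifs <;> simp

/-- The coprimality indicator as a divisor sum: for `d' ≥ 1`,
`[(d', ℓ') = 1] = ∑_{η ∣ d', η ∣ ℓ'} μ(η)`. [folklore] -/
theorem coprime_indicator_eq_sum {d' : ℕ} (hd' : d' ≠ 0) (ℓ' : ℕ) :
    (if Nat.Coprime d' ℓ' then (1 : ℂ) else 0) =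
      ∑ η ∈ d'.divisors.filter (fun η => η ∣ ℓ'), (μ η : ℂ) := by
  have hset : d'.divisors.filter (fun η => η ∣ ℓ') = (Nat.gcd d' ℓ').divisors := by
    ext η
    simp only [mem_filter, Nat.mem_divisors, Nat.dvd_gcd_iff, ne_eq, Nat.gcd_eq_zero_iff]
    tauto
  rw [hset, sum_divisors_moebius_eq_ite]

/-- **Möbius inversion of the condition `(ℓ', d') = 1`** ("this co-primality condition can be
inserted at no extra cost by Möbius inversion"): for `d' ≥ 1`,
`∑_{ℓ' ≤ L', (d',ℓ')=1} G(ℓ') = ∑_{η ∣ d'} μ(η) ∑_{ℓ'' ≤ L'/η} G(ηℓ'')`.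
[cite: FriedlanderIwaniecAnnals1998, §3, proof of Lemma 3.3] -/
theorem coprime_sum_eq_sum_divisors {d' : ℕ} (hd' : 0 < d') (L' : ℕ) (G : ℕ → ℂ) :
    ∑ ℓ' ∈ (Icc 1 L').filter (fun ℓ' => Nat.Coprime d' ℓ'), G ℓ' =
      ∑ η ∈ d'.divisors, (μ η : ℂ) * ∑ ℓ'' ∈ Icc 1 (L' / η), G (η * ℓ'') := by
  rw [sum_filter]
  have h : ∀ ℓ' ∈ Icc 1 L', (if Nat.Coprime d' ℓ' then G ℓ' else 0) =
      ∑ η ∈ d'.divisors, if η ∣ ℓ' then (μ η : ℂ) * G ℓ' else 0 := by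
    intro ℓ' _
    rw [← sum_filter, ← sum_mul, ← coprime_indicator_eq_sum hd'.ne' ℓ']
    split_ifs <;> simp
  rw [sum_congr rfl h, sum_comm]
  refine sum_congr rfl fun η hη => ?_
  have hη0 : 0 < η := Nat.pos_of_mem_divisors hη
  rw [← sum_filter, sum_filter_dvd_Icc hη0, mul_sum]

/-! ### The Weyl sums `ρ(ηm, 1; ηd₁)` and the roots modulo `d₁` -/

/-- Sums over `1 ≤ n ≤ N` in `ℤ` are sums over `[1, N]` in `ℕ`. [folklore] -/
theorem sum_Ioc_zero_int_eq {M : Type*} [AddCommMonoid M] (N : ℕ) (F : ℤ → M) :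
    ∑ n ∈ Ioc (0 : ℤ) (0 + N), F n = ∑ m ∈ Icc 1 N, F m := by
  rw [zero_add]
  refine (sum_nbij' (fun m : ℕ => (m : ℤ)) (fun n : ℤ => n.toNat) ?_ ?_ ?_ ?_ ?_).symm
  · intro m hm
    rw [mem_Icc] at hm
    rw [mem_Ioc]
    omega
  · intro n hn
    rw [mem_Ioc] at hn
    rw [mem_Icc]
    omega
  · intro m _
    simp
  · intro n hn
    rw [mem_Ioc] at hn
    simp only [Int.ofNat_toNat, sup_eq_left]
    omega
  · intro m _
    rfl

/-- **(3.6) for coefficients on `[1, M]`** (`sum_roots_norm_le` of `FriedlanderIwaniecPrimesRootSpacing`):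
`∑_{d ≤ D₁} ∑_{ν² + 1 ≡ 0 (d)} |∑_{m ≤ M} b(m) e(νm/d)| ≤ 190 √D₁ √(D₁ + M) ‖b‖`.
[cite: FriedlanderIwaniecAnnals1998, (3.6)] -/
theorem sum_sum_fiRoots_norm_le (b : ℕ → ℂ) (M D₁ : ℕ) :
    ∑ d ∈ Icc 1 D₁, ∑ ν ∈ fiRoots 1 d, ‖∑ m ∈ Icc 1 M, b m * e ((ν : ℝ) * m / d)‖ ≤
      190 * Real.sqrt D₁ * Real.sqrt (D₁ + M) * Real.sqrt (∑ m ∈ Icc 1 M, ‖b m‖ ^ 2) := by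
  have h := sum_roots_norm_le (fun n : ℤ => b n.toNat) 0 M D₁
  rw [sum_Ioc_zero_int_eq] at h
  simp only [Int.toNat_natCast] at h
  refine le_of_eq_of_le ?_ h
  refine sum_congr rfl fun d _ => ?_
  rw [fiRoots_one]
  refine sum_congr rfl fun ν _ => ?_
  rw [sum_Ioc_zero_int_eq]
  simp only [Int.toNat_natCast, Int.cast_natCast]

/-- **The Weyl sums with modulus `ηd₁` and frequencies `ηm` live on the roots modulo `d₁`, with
multiplicity at most `ρ(ηd₁)`**: for `η, d₁ ≥ 1` and coefficients `ξ''(k', ℓ'')` on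
`[1, K'] × [1, L'']`,
`|∑_{ℓ'', k'} ξ''(k',ℓ'') ρ(k'ηℓ'', 1; ηd₁)| ≤ ρ(ηd₁) ∑_{ν ∈ R(d₁)} |∑_{m ≤ K'L''} b(m) e(νm/d₁)|`,
`b(m) = ∑_{k'ℓ'' = m} ξ''(k',ℓ'')` (the phase `e(ω·ηm/(ηd₁)) = e(ωm/d₁)` depends on `ω mod d₁`,
which is a root modulo `d₁`). [cite: FriedlanderIwaniecAnnals1998, §3, proof of Lemma 3.3] -/
theorem norm_weylSum_le {η d₁ : ℕ} (hη : 0 < η) (hd₁ : 0 < d₁) (K' L'' : ℕ) (ξ'' : ℕ → ℕ → ℂ) :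
    ‖∑ ℓ'' ∈ Icc 1 L'', ∑ k' ∈ Icc 1 K', ξ'' k' ℓ'' * fiWeyl (k' * (η * ℓ'')) 1 (η * d₁)‖ ≤
      fiRho (η * d₁) * ∑ ν ∈ fiRoots 1 d₁,
        ‖∑ m ∈ Icc 1 (K' * L''),
          (∑ p ∈ (Icc 1 K' ×ˢ Icc 1 L'').filter (fun p => p.1 * p.2 = m), ξ'' p.1 p.2) *
            e ((ν : ℝ) * m / d₁)‖ := by
  have hηr : (η : ℝ) ≠ 0 := by exact_mod_cast hη.ne'
  have hd₁r : (d₁ : ℝ) ≠ 0 := by exact_mod_cast hd₁.ne'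
  -- the linear form attached to a residue `t`
  set G : ℕ → ℂ := fun t => ∑ m ∈ Icc 1 (K' * L''),
    (∑ p ∈ (Icc 1 K' ×ˢ Icc 1 L'').filter (fun p => p.1 * p.2 = m), ξ'' p.1 p.2) *
      e ((t : ℝ) * m / d₁) with hG
  -- Step 1: the double sum is `∑_{ω ∈ R(ηd₁)} G(ω)`
  have hph : ∀ (ω k' ℓ'' : ℕ), e ((ω : ℝ) * ((k' * (η * ℓ'') : ℕ) : ℝ) / ((η * d₁ : ℕ) : ℝ)) =
      e ((ω : ℝ) * ((k' * ℓ'' : ℕ) : ℝ) / d₁) := by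
    intro ω k' ℓ''
    congr 1
    push_cast
    field_simp
  have h1 : ∀ ℓ'' k' : ℕ, ξ'' k' ℓ'' * fiWeyl (k' * (η * ℓ'')) 1 (η * d₁) =
      ∑ ω ∈ fiRoots 1 (η * d₁), ξ'' k' ℓ'' * e ((ω : ℝ) * ((k' * ℓ'' : ℕ) : ℝ) / d₁) := by
    intro ℓ'' k'
    rw [fiWeyl, mul_sum]
    exact sum_congr rfl fun ω _ => by rw [hph]
  have hG' : ∀ ω : ℕ, ∑ ℓ'' ∈ Icc 1 L'', ∑ k' ∈ Icc 1 K',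
      ξ'' k' ℓ'' * e ((ω : ℝ) * ((k' * ℓ'' : ℕ) : ℝ) / d₁) = G ω := by
    intro ω
    set F : ℕ → ℕ → ℂ := fun k' ℓ'' => ξ'' k' ℓ'' * e ((ω : ℝ) * ((k' * ℓ'' : ℕ) : ℝ) / d₁)
      with hF
    have hprod : ∑ ℓ'' ∈ Icc 1 L'', ∑ k' ∈ Icc 1 K', F k' ℓ'' =
        ∑ p ∈ Icc 1 K' ×ˢ Icc 1 L'', F p.1 p.2 := (sum_product_right' _ _ _).symm
    rw [hprod, ← sum_fiberwise_of_maps_to (g := fun p : ℕ × ℕ => p.1 * p.2)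
      (t := Icc 1 (K' * L''))]
    · simp only [hG]
      refine sum_congr rfl fun m _ => ?_
      rw [sum_mul]
      refine sum_congr rfl fun p hp => ?_
      rw [hF]
      simp only
      rw [(mem_filter.mp hp).2]
    · intro p hp
      rw [mem_product, mem_Icc, mem_Icc] at hp
      rw [mem_Icc]
      exact ⟨Nat.mul_pos hp.1.1 hp.2.1, Nat.mul_le_mul hp.1.2 hp.2.2⟩
  have hstep1 : ∑ ℓ'' ∈ Icc 1 L'', ∑ k' ∈ Icc 1 K', ξ'' k' ℓ'' * fiWeyl (k' * (η * ℓ'')) 1 (η * d₁)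
      = ∑ ω ∈ fiRoots 1 (η * d₁), G ω := by
    simp_rw [h1]
    rw [sum_congr rfl fun ℓ'' _ => sum_comm, sum_comm]
    exact sum_congr rfl fun ω _ => hG' ω
  -- Step 2: `G(ω) = G(ω mod d₁)` and `ω mod d₁` is a root modulo `d₁`
  have hper : ∀ ω : ℕ, G ω = G (ω % d₁) := by
    intro ω
    rw [hG]
    refine sum_congr rfl fun m _ => ?_
    congr 1
    have hdiv := Nat.div_add_mod ω d₁
    set q := ω / d₁
    set r := ω % d₁
    have hr : (ω : ℝ) = d₁ * q + r := by exact_mod_cast hdiv.symm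
    have : (ω : ℝ) * m / d₁ = (r : ℝ) * m / d₁ + ((q * m : ℕ) : ℤ) := by
      rw [hr]
      push_cast
      field_simp
      ring
    rw [this, e_add_int]
  have hroot : ∀ ω ∈ fiRoots 1 (η * d₁), ω % d₁ ∈ fiRoots 1 d₁ := by
    intro ω hω
    rw [mem_fiRoots] at hω ⊢
    refine ⟨Nat.mod_lt _ hd₁, ?_⟩
    have h2 : d₁ ∣ ω ^ 2 + 1 ^ 2 := (Dvd.intro_left η rfl).trans hω.2
    have h3 : (ω % d₁) ^ 2 + 1 ^ 2 ≡ ω ^ 2 + 1 ^ 2 [MOD d₁] :=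
      ((Nat.mod_modEq ω d₁).pow 2).add_right _
    exact (Nat.modEq_zero_iff_dvd.mpr h2 |> h3.trans |> Nat.modEq_zero_iff_dvd.mp)
  -- Step 3: the bound
  rw [hstep1]
  calc ‖∑ ω ∈ fiRoots 1 (η * d₁), G ω‖
      ≤ ∑ ω ∈ fiRoots 1 (η * d₁), ‖G ω‖ := norm_sum_le _ _
    _ ≤ ∑ ω ∈ fiRoots 1 (η * d₁), ∑ ν ∈ fiRoots 1 d₁, ‖G ν‖ := by
        refine sum_le_sum fun ω hω => ?_
        rw [hper ω]
        exact single_le_sum (f := fun ν => ‖G ν‖) (fun _ _ => norm_nonneg _) (hroot ω hω)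
    _ = fiRho (η * d₁) * ∑ ν ∈ fiRoots 1 d₁, ‖G ν‖ := by
        rw [sum_const, nsmul_eq_mul, card_fiRoots_one]

/-! ### The coefficients `b(m) = ∑_{k'ℓ'' = m} ξ''(k', ℓ'')` -/

/-- **`‖b‖² ≤ τ_max ‖ξ''‖²`**: grouping the coefficients by the product `m = k'ℓ''` costs the
divisor function, `∑_m |∑_{k'ℓ''=m} ξ''(k',ℓ'')|² ≤ T ∑_{k',ℓ''} |ξ''(k',ℓ'')|²` when `τ(m) ≤ T`
for `m ≤ K'L''` (Cauchy's inequality; the fibre of `m` has at most `τ(m)` elements).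
[cite: FriedlanderIwaniecAnnals1998, §3, proof of Lemma 3.3] -/
theorem sum_norm_prodCoeff_sq_le {T : ℕ} (K' L'' : ℕ) (ξ'' : ℕ → ℕ → ℂ)
    (hT : ∀ m, m ≠ 0 → m ≤ K' * L'' → #m.divisors ≤ T) :
    ∑ m ∈ Icc 1 (K' * L''),
        ‖∑ p ∈ (Icc 1 K' ×ˢ Icc 1 L'').filter (fun p => p.1 * p.2 = m), ξ'' p.1 p.2‖ ^ 2 ≤
      T * ∑ p ∈ Icc 1 K' ×ˢ Icc 1 L'', ‖ξ'' p.1 p.2‖ ^ 2 := by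
  set box := Icc 1 K' ×ˢ Icc 1 L'' with hbox
  have hmaps : ∀ p ∈ box, p.1 * p.2 ∈ Icc 1 (K' * L'') := by
    intro p hp
    rw [hbox, mem_product, mem_Icc, mem_Icc] at hp
    rw [mem_Icc]
    exact ⟨Nat.mul_pos hp.1.1 hp.2.1, Nat.mul_le_mul hp.1.2 hp.2.2⟩
  have hcard : ∀ m ∈ Icc 1 (K' * L''), (#(box.filter (fun p => p.1 * p.2 = m)) : ℝ) ≤ T := by
    intro m hm
    rw [mem_Icc] at hm
    have hm0 : m ≠ 0 := by omega
    have h1 : #(box.filter (fun p => p.1 * p.2 = m)) ≤ #m.divisors := by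
      refine card_le_card_of_injOn (fun p => p.1) (fun p hp => ?_) ?_
      · have hp' := (mem_filter.mp hp).2
        exact Nat.mem_divisors.mpr ⟨⟨p.2, hp'.symm⟩, hm0⟩
      · intro p hp q hq h
        have hp' := mem_filter.mp (mem_coe.mp hp)
        have hq' := mem_filter.mp (mem_coe.mp hq)
        have hp1 : 0 < p.1 := by
          have := hp'.1; rw [hbox, mem_product, mem_Icc] at this; omega
        have h2 : p.1 * p.2 = p.1 * q.2 := by
          simp only at h
          rw [hp'.2, h, hq'.2]
        exact Prod.ext h (Nat.eq_of_mul_eq_mul_left hp1 h2)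
    exact_mod_cast h1.trans (hT m hm0 hm.2)
  calc ∑ m ∈ Icc 1 (K' * L''), ‖∑ p ∈ box.filter (fun p => p.1 * p.2 = m), ξ'' p.1 p.2‖ ^ 2
      ≤ ∑ m ∈ Icc 1 (K' * L''), (#(box.filter (fun p => p.1 * p.2 = m)) : ℝ) *
          ∑ p ∈ box.filter (fun p => p.1 * p.2 = m), ‖ξ'' p.1 p.2‖ ^ 2 := by
        refine sum_le_sum fun m _ => ?_
        calc ‖∑ p ∈ box.filter (fun p => p.1 * p.2 = m), ξ'' p.1 p.2‖ ^ 2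
            ≤ (∑ p ∈ box.filter (fun p => p.1 * p.2 = m), ‖ξ'' p.1 p.2‖) ^ 2 :=
              pow_le_pow_left₀ (norm_nonneg _) (norm_sum_le _ _) 2
          _ ≤ _ := sq_sum_le_card_mul_sum_sq
    _ ≤ ∑ m ∈ Icc 1 (K' * L''), (T : ℝ) *
          ∑ p ∈ box.filter (fun p => p.1 * p.2 = m), ‖ξ'' p.1 p.2‖ ^ 2 :=
        sum_le_sum fun m hm => mul_le_mul_of_nonneg_right (hcard m hm)
          (sum_nonneg fun _ _ => by positivity)
    _ = T * ∑ p ∈ box, ‖ξ'' p.1 p.2‖ ^ 2 := by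
        rw [← mul_sum, sum_fiberwise_of_maps_to hmaps]

/-! ### Lemma 3.3 for the reduced linear forms (fixed `γ, δ`) -/

/-- **The reduced linear forms** (the heart of the proof of Lemma 3.3): for coefficients `ξ'` on
`[1, K'] × [1, L']`, with `ρ(n) ≤ C τ(n)` and `τ(n) ≤ T` for all relevant `n`,
`∑_{d' ≤ D'} |∑_{ℓ' ≤ L', (d',ℓ')=1} ∑_{k' ≤ K'} ξ'(k',ℓ') ρ(k'ℓ', 1; d')|
   ≤ 190√2 · C T² · √D' √(D' + K'L') · ‖ξ'‖`:
Möbius inversion of `(d', ℓ') = 1` (`coprime_sum_eq_sum_divisors`), `d' = ηd₁`, the Weyl sums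
modulo `ηd₁` bounded through the roots modulo `d₁` (`norm_weylSum_le`), (3.6) with the ranges
`D'/η`, `K'L'/η` (`sum_sum_fiRoots_norm_le`), `‖b_η‖² ≤ T s_η` (`sum_norm_prodCoeff_sq_le`), and
Cauchy's inequality `∑_η η⁻¹ √s_η ≤ (∑ η⁻²)^{1/2} (∑ s_η)^{1/2} ≤ √2 √T ‖ξ'‖`.
[cite: FriedlanderIwaniecAnnals1998, §3, proof of Lemma 3.3] -/
theorem sum_norm_coprime_sum_le {C T N₀ : ℕ} (hC : ∀ n, n ≠ 0 → fiRho n ≤ C * #n.divisors)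
    (hT : ∀ n, n ≠ 0 → n ≤ N₀ → #n.divisors ≤ T) {D' K' L' : ℕ} (hD : D' ≤ N₀)
    (hKL : K' * L' ≤ N₀) (hL : L' ≤ N₀) (ξ' : ℕ → ℕ → ℂ) :
    ∑ d' ∈ Icc 1 D', ‖∑ ℓ' ∈ (Icc 1 L').filter (fun ℓ' => Nat.Coprime d' ℓ'),
        ∑ k' ∈ Icc 1 K', ξ' k' ℓ' * fiWeyl (k' * ℓ') 1 d'‖ ≤
      190 * Real.sqrt 2 * C * T ^ 2 * (Real.sqrt D' * Real.sqrt (D' + K' * L')) *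
        Real.sqrt (∑ k' ∈ Icc 1 K', ∑ ℓ' ∈ Icc 1 L', ‖ξ' k' ℓ'‖ ^ 2) := by
  set Ξ : ℝ := ∑ k' ∈ Icc 1 K', ∑ ℓ' ∈ Icc 1 L', ‖ξ' k' ℓ'‖ ^ 2 with hΞ
  set W : ℕ → ℕ → ℂ := fun η d' => ∑ ℓ'' ∈ Icc 1 (L' / η), ∑ k' ∈ Icc 1 K',
    ξ' k' (η * ℓ'') * fiWeyl (k' * (η * ℓ'')) 1 d' with hW
  set s : ℕ → ℝ := fun η => ∑ p ∈ Icc 1 K' ×ˢ Icc 1 (L' / η), ‖ξ' p.1 (η * p.2)‖ ^ 2 with hs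
  set R : ℝ := Real.sqrt D' * Real.sqrt (D' + K' * L') with hR
  have hΞ0 : 0 ≤ Ξ := sum_nonneg fun _ _ => sum_nonneg fun _ _ => by positivity
  have hs0 : ∀ η, 0 ≤ s η := fun η => sum_nonneg fun _ _ => by positivity
  have hR0 : 0 ≤ R := by positivity
  -- Step 1: Möbius
  have h1 : ∀ d' ∈ Icc 1 D', ‖∑ ℓ' ∈ (Icc 1 L').filter (fun ℓ' => Nat.Coprime d' ℓ'),
      ∑ k' ∈ Icc 1 K', ξ' k' ℓ' * fiWeyl (k' * ℓ') 1 d'‖ ≤ ∑ η ∈ d'.divisors, ‖W η d'‖ := by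
    intro d' hd'
    rw [mem_Icc] at hd'
    rw [coprime_sum_eq_sum_divisors (by omega : 0 < d') L'
      (fun ℓ' => ∑ k' ∈ Icc 1 K', ξ' k' ℓ' * fiWeyl (k' * ℓ') 1 d')]
    refine (norm_sum_le _ _).trans (sum_le_sum fun η _ => ?_)
    rw [norm_mul]
    have hμ : ‖(μ η : ℂ)‖ ≤ 1 := by
      rw [Complex.norm_intCast]
      exact_mod_cast ArithmeticFunction.abs_moebius_le_one
    calc ‖(μ η : ℂ)‖ * ‖∑ ℓ'' ∈ Icc 1 (L' / η), ∑ k' ∈ Icc 1 K',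
          ξ' k' (η * ℓ'') * fiWeyl (k' * (η * ℓ'')) 1 d'‖ ≤ 1 * ‖W η d'‖ :=
          mul_le_mul_of_nonneg_right hμ (norm_nonneg _)
      _ = ‖W η d'‖ := one_mul _
  -- Step 2: for each `η`, the moduli `d' = ηd₁`
  have h2 : ∀ η ∈ Icc 1 D', ∑ d₁ ∈ Icc 1 (D' / η), ‖W η (η * d₁)‖ ≤
      (C * T : ℝ) * (190 * (R / η) * (Real.sqrt T * Real.sqrt (s η))) := by
    intro η hη
    rw [mem_Icc] at hη
    have hη0 : 0 < η := by omega
    have hηr : (0 : ℝ) < η := by exact_mod_cast hη0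
    set b : ℕ → ℂ := fun m => ∑ p ∈ (Icc 1 K' ×ˢ Icc 1 (L' / η)).filter
      (fun p => p.1 * p.2 = m), ξ' p.1 (η * p.2) with hb
    have hWle : ∀ d₁ ∈ Icc 1 (D' / η), ‖W η (η * d₁)‖ ≤ (C * T : ℝ) *
        ∑ ν ∈ fiRoots 1 d₁, ‖∑ m ∈ Icc 1 (K' * (L' / η)), b m * e ((ν : ℝ) * m / d₁)‖ := by
      intro d₁ hd₁
      rw [mem_Icc] at hd₁
      have hd₁0 : 0 < d₁ := by omega
      refine (norm_weylSum_le hη0 hd₁0 K' (L' / η) (fun k' ℓ'' => ξ' k' (η * ℓ''))).trans ?_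
      refine mul_le_mul_of_nonneg_right ?_ (sum_nonneg fun _ _ => norm_nonneg _)
      have hn0 : η * d₁ ≠ 0 := (Nat.mul_pos hη0 hd₁0).ne'
      have hle : η * d₁ ≤ N₀ :=
        calc η * d₁ ≤ η * (D' / η) := Nat.mul_le_mul_left η hd₁.2
          _ ≤ D' := Nat.mul_div_le D' η
          _ ≤ N₀ := hD
      exact_mod_cast (hC _ hn0).trans (Nat.mul_le_mul_left C (hT _ hn0 hle))
    -- the square-mean of `b`
    have hbT : Real.sqrt (∑ m ∈ Icc 1 (K' * (L' / η)), ‖b m‖ ^ 2) ≤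
        Real.sqrt T * Real.sqrt (s η) := by
      rw [← Real.sqrt_mul (Nat.cast_nonneg T)]
      refine Real.sqrt_le_sqrt ?_
      refine sum_norm_prodCoeff_sq_le K' (L' / η) (fun k' ℓ'' => ξ' k' (η * ℓ'')) fun m hm0 hm => ?_
      refine hT m hm0 (hm.trans (le_trans ?_ hKL))
      exact Nat.mul_le_mul_left K' (Nat.div_le_self L' η)
    -- the ranges
    have hA : Real.sqrt ((D' / η : ℕ) : ℝ) *
        Real.sqrt (((D' / η : ℕ) : ℝ) + ((K' * (L' / η) : ℕ) : ℝ)) ≤ R / η := by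
      have e1 : ((D' / η : ℕ) : ℝ) ≤ (D' : ℝ) / η := Nat.cast_div_le
      have e2 : ((K' * (L' / η) : ℕ) : ℝ) ≤ (K' : ℝ) * L' / η := by
        push_cast
        calc (K' : ℝ) * ((L' / η : ℕ) : ℝ) ≤ K' * ((L' : ℝ) / η) := by
              gcongr
              exact Nat.cast_div_le
          _ = K' * L' / η := by ring
      have e3 : Real.sqrt ((D' : ℝ) / η) * Real.sqrt ((D' : ℝ) / η + K' * L' / η) = R / η := by
        rw [show (D' : ℝ) / η + K' * L' / η = (D' + K' * L') / η by ring,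
          Real.sqrt_div (Nat.cast_nonneg D'), Real.sqrt_div (by positivity), hR,
          div_mul_div_comm, Real.mul_self_sqrt hηr.le]
      rw [← e3]
      gcongr
    calc ∑ d₁ ∈ Icc 1 (D' / η), ‖W η (η * d₁)‖
        ≤ ∑ d₁ ∈ Icc 1 (D' / η), (C * T : ℝ) *
            ∑ ν ∈ fiRoots 1 d₁, ‖∑ m ∈ Icc 1 (K' * (L' / η)), b m * e ((ν : ℝ) * m / d₁)‖ :=
          sum_le_sum hWle
      _ = (C * T : ℝ) * ∑ d₁ ∈ Icc 1 (D' / η),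
            ∑ ν ∈ fiRoots 1 d₁, ‖∑ m ∈ Icc 1 (K' * (L' / η)), b m * e ((ν : ℝ) * m / d₁)‖ :=
          (mul_sum _ _ _).symm
      _ ≤ (C * T : ℝ) * (190 * Real.sqrt ((D' / η : ℕ) : ℝ) *
            Real.sqrt (((D' / η : ℕ) : ℝ) + ((K' * (L' / η) : ℕ) : ℝ)) *
            Real.sqrt (∑ m ∈ Icc 1 (K' * (L' / η)), ‖b m‖ ^ 2)) :=
          mul_le_mul_of_nonneg_left (sum_sum_fiRoots_norm_le b _ _) (by positivity)
      _ ≤ (C * T : ℝ) * (190 * (R / η) * (Real.sqrt T * Real.sqrt (s η))) := by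
          refine mul_le_mul_of_nonneg_left ?_ (by positivity)
          calc 190 * Real.sqrt ((D' / η : ℕ) : ℝ) *
                Real.sqrt (((D' / η : ℕ) : ℝ) + ((K' * (L' / η) : ℕ) : ℝ)) *
                Real.sqrt (∑ m ∈ Icc 1 (K' * (L' / η)), ‖b m‖ ^ 2)
              = 190 * (Real.sqrt ((D' / η : ℕ) : ℝ) *
                  Real.sqrt (((D' / η : ℕ) : ℝ) + ((K' * (L' / η) : ℕ) : ℝ))) *
                  Real.sqrt (∑ m ∈ Icc 1 (K' * (L' / η)), ‖b m‖ ^ 2) := by ring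
            _ ≤ 190 * (R / η) * (Real.sqrt T * Real.sqrt (s η)) := by
                gcongr
  -- Step 3: summation over `η`
  have h3 : ∑ η ∈ Icc 1 D', (η : ℝ)⁻¹ * Real.sqrt (s η) ≤
      Real.sqrt 2 * (Real.sqrt T * Real.sqrt Ξ) := by
    have hcs := Real.sum_mul_le_sqrt_mul_sqrt (Icc 1 D') (fun η => (η : ℝ)⁻¹)
      (fun η => Real.sqrt (s η))
    refine hcs.trans ?_
    have e1 : Real.sqrt (∑ η ∈ Icc 1 D', ((η : ℝ)⁻¹) ^ 2) ≤ Real.sqrt 2 := by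
      refine Real.sqrt_le_sqrt ?_
      simp_rw [inv_pow]
      exact sum_Icc_inv_sq_le_two D'
    have e2 : Real.sqrt (∑ η ∈ Icc 1 D', Real.sqrt (s η) ^ 2) ≤ Real.sqrt T * Real.sqrt Ξ := by
      rw [← Real.sqrt_mul (Nat.cast_nonneg T)]
      refine Real.sqrt_le_sqrt ?_
      simp_rw [Real.sq_sqrt (hs0 _)]
      -- `∑_η s η ≤ T Ξ`
      calc ∑ η ∈ Icc 1 D', s η
          = ∑ η ∈ Icc 1 D', ∑ k' ∈ Icc 1 K', ∑ ℓ'' ∈ Icc 1 (L' / η), ‖ξ' k' (η * ℓ'')‖ ^ 2 := by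
            refine sum_congr rfl fun η _ => ?_
            rw [hs]
            exact sum_product _ _ _
        _ = ∑ k' ∈ Icc 1 K', ∑ η ∈ Icc 1 D', ∑ ℓ'' ∈ Icc 1 (L' / η), ‖ξ' k' (η * ℓ'')‖ ^ 2 :=
            sum_comm
        _ ≤ ∑ k' ∈ Icc 1 K', (T : ℝ) * ∑ ℓ' ∈ Icc 1 L', ‖ξ' k' ℓ'‖ ^ 2 := by
            refine sum_le_sum fun k' _ => ?_
            exact sum_sum_div_le D' L' (fun ℓ => ‖ξ' k' ℓ‖ ^ 2) (fun _ => by positivity)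
              fun ℓ hℓ0 hℓ => hT ℓ hℓ0 (hℓ.trans hL)
        _ = T * Ξ := by rw [hΞ, mul_sum]
    exact mul_le_mul e1 e2 (Real.sqrt_nonneg _) (Real.sqrt_nonneg _)
  -- assembly
  have hTT : Real.sqrt T * Real.sqrt T = T := Real.mul_self_sqrt (Nat.cast_nonneg T)
  calc ∑ d' ∈ Icc 1 D', ‖∑ ℓ' ∈ (Icc 1 L').filter (fun ℓ' => Nat.Coprime d' ℓ'),
          ∑ k' ∈ Icc 1 K', ξ' k' ℓ' * fiWeyl (k' * ℓ') 1 d'‖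
      ≤ ∑ d' ∈ Icc 1 D', ∑ η ∈ d'.divisors, ‖W η d'‖ := sum_le_sum h1
    _ = ∑ η ∈ Icc 1 D', ∑ d₁ ∈ Icc 1 (D' / η), ‖W η (η * d₁)‖ :=
        sum_Icc_sum_divisors_eq D' (fun η d' => ‖W η d'‖)
    _ ≤ ∑ η ∈ Icc 1 D', (C * T : ℝ) * (190 * (R / η) * (Real.sqrt T * Real.sqrt (s η))) :=
        sum_le_sum h2
    _ = (C * T : ℝ) * (190 * R * Real.sqrt T) *
          ∑ η ∈ Icc 1 D', (η : ℝ)⁻¹ * Real.sqrt (s η) := by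
        rw [mul_sum]
        refine sum_congr rfl fun η _ => ?_
        rw [div_eq_mul_inv]
        ring
    _ ≤ (C * T : ℝ) * (190 * R * Real.sqrt T) * (Real.sqrt 2 * (Real.sqrt T * Real.sqrt Ξ)) :=
        mul_le_mul_of_nonneg_left h3 (by positivity)
    _ = 190 * Real.sqrt 2 * C * (T * (Real.sqrt T * Real.sqrt T)) * R * Real.sqrt Ξ := by ring
    _ = 190 * Real.sqrt 2 * C * T ^ 2 * R * Real.sqrt Ξ := by rw [hTT]; ring

/-! ### Lemma 3.3 -/

/-- **FI Lemma 3.3 with explicit dependence on the divisor function.** Let `ρ(n) ≤ C τ(n)` for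
all `n ≥ 1` (`exists_fiRho_le_mul_card_divisors`) and `τ(n) ≤ T` for `1 ≤ n ≤ DKL²`. Then for all
complex `ξ(k, ℓ)`,
`∑_{d ≤ D} |∑_{k ≤ K} ∑_{ℓ ≤ L} ξ(k,ℓ) ρ(k,ℓ;d)| ≤ 270 · C T³ · (1 + log D)^{1/2} · √D √(D + KL) · ‖ξ‖`,
`‖ξ‖² = ∑_{k,ℓ} |ξ(k,ℓ)|²`. Proof as in FI §3: group `ℓ` by `(d, ℓ²) = g = γδ²`
(`sum_Icc_eq_sum_divisors_fiber`, `Nat.sq_mul_squarefree_of_pos`), apply (3.9)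
(`norm_fiber_sum_le`) and the reduced estimate `sum_norm_coprime_sum_le` with the ranges
`D/g`, `K/δ`, `L/(γδ)`, and sum over `g` with `δ/g = 1/(γδ) ≤ g^{-1/2}`, Cauchy's inequality,
`∑_{g ≤ D} g⁻¹ ≤ 1 + log D` and `#{g ≤ D : g ∣ ℓ²} ≤ τ(ℓ²) ≤ T`.
[cite: FriedlanderIwaniecAnnals1998, Lemma 3.3] -/
theorem fi_lemma33_core {C T : ℕ} (hC : ∀ n, n ≠ 0 → fiRho n ≤ C * #n.divisors) (D K L : ℕ)
    (hT : ∀ n, n ≠ 0 → n ≤ D * K * L * L → #n.divisors ≤ T) (ξ : ℕ → ℕ → ℂ) :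
    ∑ d ∈ Icc 1 D, ‖∑ k ∈ Icc 1 K, ∑ ℓ ∈ Icc 1 L, ξ k ℓ * fiWeyl k ℓ d‖ ≤
      270 * C * T ^ 3 * Real.sqrt (1 + Real.log D) * (Real.sqrt D * Real.sqrt (D + K * L)) *
        Real.sqrt (∑ k ∈ Icc 1 K, ∑ ℓ ∈ Icc 1 L, ‖ξ k ℓ‖ ^ 2) := by
  -- degenerate cases
  rcases Nat.eq_zero_or_pos K with rfl | hK
  · simp
  rcases Nat.eq_zero_or_pos L with rfl | hL
  · simp
  rcases Nat.eq_zero_or_pos D with rfl | hD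
  · simp
  set N₀ := D * K * L * L with hN₀
  have hN₀1 : 1 ≤ N₀ := Nat.mul_pos (Nat.mul_pos (Nat.mul_pos hD hK) hL) hL
  have hT1 : 1 ≤ T := by simpa using hT 1 one_ne_zero hN₀1
  have hT1r : (1 : ℝ) ≤ T := by exact_mod_cast hT1
  set Ξ : ℝ := ∑ k ∈ Icc 1 K, ∑ ℓ ∈ Icc 1 L, ‖ξ k ℓ‖ ^ 2 with hΞ
  set R : ℝ := Real.sqrt D * Real.sqrt (D + K * L) with hR
  set E : ℕ → ℝ := fun g => ∑ k ∈ Icc 1 K, ∑ ℓ ∈ (Icc 1 L).filter (fun ℓ => g ∣ ℓ ^ 2),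
    ‖ξ k ℓ‖ ^ 2 with hE
  have hΞ0 : 0 ≤ Ξ := sum_nonneg fun _ _ => sum_nonneg fun _ _ => by positivity
  have hE0 : ∀ g, 0 ≤ E g := fun g => sum_nonneg fun _ _ => sum_nonneg fun _ _ => by positivity
  have hR0 : 0 ≤ R := by positivity
  -- Step 1: fibres `(d, ℓ²) = g` and the swap `d = g d'`
  have h1 : ∑ d ∈ Icc 1 D, ‖∑ k ∈ Icc 1 K, ∑ ℓ ∈ Icc 1 L, ξ k ℓ * fiWeyl k ℓ d‖ ≤
      ∑ g ∈ Icc 1 D, ∑ d' ∈ Icc 1 (D / g),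
        ‖∑ ℓ ∈ (Icc 1 L).filter (fun ℓ => Nat.gcd (g * d') (ℓ ^ 2) = g),
          ∑ k ∈ Icc 1 K, ξ k ℓ * fiWeyl k ℓ (g * d')‖ := by
    rw [← sum_Icc_sum_divisors_eq D (fun g d =>
      ‖∑ ℓ ∈ (Icc 1 L).filter (fun ℓ => Nat.gcd d (ℓ ^ 2) = g),
        ∑ k ∈ Icc 1 K, ξ k ℓ * fiWeyl k ℓ d‖)]
    refine sum_le_sum fun d hd => ?_
    rw [mem_Icc] at hd
    rw [sum_comm, sum_Icc_eq_sum_divisors_fiber (by omega : d ≠ 0) L]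
    exact norm_sum_le _ _
  -- Step 2: the bound for each `g = γδ²`
  have h2 : ∀ g ∈ Icc 1 D, ∑ d' ∈ Icc 1 (D / g),
      ‖∑ ℓ ∈ (Icc 1 L).filter (fun ℓ => Nat.gcd (g * d') (ℓ ^ 2) = g),
        ∑ k ∈ Icc 1 K, ξ k ℓ * fiWeyl k ℓ (g * d')‖ ≤
      190 * Real.sqrt 2 * C * T ^ 2 * R * ((Real.sqrt g)⁻¹ * Real.sqrt (E g)) := by
    intro g hg
    rw [mem_Icc] at hg
    obtain ⟨γ, δ, hγ0, hδ0, hgeq, hγ⟩ := Nat.sq_mul_squarefree_of_pos (by omega : 0 < g)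
    have hg' : g = γ * δ ^ 2 := by rw [← hgeq]; ring
    subst hg'
    have hγδ0 : 0 < γ * δ := Nat.mul_pos hγ0 hδ0
    have hgpos : (0 : ℝ) < (γ * δ ^ 2 : ℕ) := by exact_mod_cast hg.1
    -- ranges of the reduced problem
    have hD' : D / (γ * δ ^ 2) ≤ N₀ := (Nat.div_le_self _ _).trans
      (by rw [hN₀]; exact le_trans (le_trans (Nat.le_mul_of_pos_right D hK)
        (Nat.le_mul_of_pos_right _ hL)) (Nat.le_mul_of_pos_right _ hL))
    have hKL' : K / δ * (L / (γ * δ)) ≤ N₀ := by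
      calc K / δ * (L / (γ * δ)) ≤ K * L := Nat.mul_le_mul (Nat.div_le_self _ _) (Nat.div_le_self _ _)
        _ ≤ N₀ := by
          rw [hN₀]
          calc K * L = 1 * K * L * 1 := by ring
            _ ≤ D * K * L * L := by gcongr <;> omega
    have hL' : L / (γ * δ) ≤ N₀ := (Nat.div_le_self _ _).trans (by
      rw [hN₀]
      calc L = 1 * 1 * L * 1 := by ring
        _ ≤ D * K * L * L := by gcongr <;> omega)
    -- (3.9) fibrewise, then the reduced estimate
    have hstep : ∑ d' ∈ Icc 1 (D / (γ * δ ^ 2)),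
        ‖∑ ℓ ∈ (Icc 1 L).filter (fun ℓ => Nat.gcd (γ * δ ^ 2 * d') (ℓ ^ 2) = γ * δ ^ 2),
          ∑ k ∈ Icc 1 K, ξ k ℓ * fiWeyl k ℓ (γ * δ ^ 2 * d')‖ ≤
        δ * (190 * Real.sqrt 2 * C * T ^ 2 *
          (Real.sqrt ((D / (γ * δ ^ 2) : ℕ) : ℝ) *
            Real.sqrt (((D / (γ * δ ^ 2) : ℕ) : ℝ) + ((K / δ : ℕ) : ℝ) * ((L / (γ * δ) : ℕ) : ℝ))) *
          Real.sqrt (∑ k' ∈ Icc 1 (K / δ), ∑ ℓ' ∈ Icc 1 (L / (γ * δ)),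
            ‖ξ (δ * k') (γ * δ * ℓ')‖ ^ 2)) := by
      calc _ ≤ ∑ d' ∈ Icc 1 (D / (γ * δ ^ 2)), (δ : ℝ) *
            ‖∑ ℓ' ∈ (Icc 1 (L / (γ * δ))).filter (fun ℓ' => Nat.Coprime d' ℓ'),
              ∑ k' ∈ Icc 1 (K / δ), ξ (δ * k') (γ * δ * ℓ') * fiWeyl (k' * ℓ') 1 d'‖ := by
            refine sum_le_sum fun d' hd' => ?_
            rw [mem_Icc] at hd'
            exact norm_fiber_sum_le hγ hγ0 hδ0 (by omega) K L ξ
        _ = (δ : ℝ) * ∑ d' ∈ Icc 1 (D / (γ * δ ^ 2)),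
            ‖∑ ℓ' ∈ (Icc 1 (L / (γ * δ))).filter (fun ℓ' => Nat.Coprime d' ℓ'),
              ∑ k' ∈ Icc 1 (K / δ), ξ (δ * k') (γ * δ * ℓ') * fiWeyl (k' * ℓ') 1 d'‖ :=
            (mul_sum _ _ _).symm
        _ ≤ _ := by
            refine mul_le_mul_of_nonneg_left ?_ (Nat.cast_nonneg δ)
            exact sum_norm_coprime_sum_le hC hT hD' hKL' hL' (fun k' ℓ' => ξ (δ * k') (γ * δ * ℓ'))
    refine hstep.trans ?_
    -- real-variable clean-up: ranges and the norm
    have hA : (δ : ℝ) * (Real.sqrt ((D / (γ * δ ^ 2) : ℕ) : ℝ) *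
        Real.sqrt (((D / (γ * δ ^ 2) : ℕ) : ℝ) + ((K / δ : ℕ) : ℝ) * ((L / (γ * δ) : ℕ) : ℝ))) ≤
        R * (Real.sqrt ((γ * δ ^ 2 : ℕ) : ℝ))⁻¹ := by
      have e1 : ((D / (γ * δ ^ 2) : ℕ) : ℝ) ≤ (D : ℝ) / ((γ * δ ^ 2 : ℕ) : ℝ) := Nat.cast_div_le
      have e2 : ((K / δ : ℕ) : ℝ) * ((L / (γ * δ) : ℕ) : ℝ) ≤ (K : ℝ) * L / ((γ * δ ^ 2 : ℕ) : ℝ) := by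
        have f1 : ((K / δ : ℕ) : ℝ) ≤ (K : ℝ) / δ := Nat.cast_div_le
        have f2 : ((L / (γ * δ) : ℕ) : ℝ) ≤ (L : ℝ) / ((γ * δ : ℕ) : ℝ) := Nat.cast_div_le
        calc ((K / δ : ℕ) : ℝ) * ((L / (γ * δ) : ℕ) : ℝ) ≤ (K : ℝ) / δ * ((L : ℝ) / ((γ * δ : ℕ) : ℝ)) :=
              mul_le_mul f1 f2 (Nat.cast_nonneg _) (by positivity)
          _ = (K : ℝ) * L / ((γ * δ ^ 2 : ℕ) : ℝ) := by
              push_cast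
              field_simp
      have e3 : Real.sqrt ((D : ℝ) / ((γ * δ ^ 2 : ℕ) : ℝ)) *
          Real.sqrt ((D : ℝ) / ((γ * δ ^ 2 : ℕ) : ℝ) + (K : ℝ) * L / ((γ * δ ^ 2 : ℕ) : ℝ)) =
          R / ((γ * δ ^ 2 : ℕ) : ℝ) := by
        rw [show (D : ℝ) / ((γ * δ ^ 2 : ℕ) : ℝ) + (K : ℝ) * L / ((γ * δ ^ 2 : ℕ) : ℝ) =
            ((D : ℝ) + K * L) / ((γ * δ ^ 2 : ℕ) : ℝ) by ring,
          Real.sqrt_div (Nat.cast_nonneg D), Real.sqrt_div (by positivity), hR,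
          div_mul_div_comm, Real.mul_self_sqrt hgpos.le]
      -- `δ / g = 1/(γδ) ≤ g^{-1/2}`
      have e4 : (δ : ℝ) / ((γ * δ ^ 2 : ℕ) : ℝ) ≤ (Real.sqrt ((γ * δ ^ 2 : ℕ) : ℝ))⁻¹ := by
        have hδg : (δ : ℝ) ^ 2 ≤ ((γ * δ ^ 2 : ℕ) : ℝ) := by
          exact_mod_cast Nat.le_mul_of_pos_left (δ ^ 2) hγ0
        have key : (δ : ℝ) * Real.sqrt ((γ * δ ^ 2 : ℕ) : ℝ) ≤ ((γ * δ ^ 2 : ℕ) : ℝ) := by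
          calc (δ : ℝ) * Real.sqrt ((γ * δ ^ 2 : ℕ) : ℝ)
              = Real.sqrt ((δ : ℝ) ^ 2) * Real.sqrt ((γ * δ ^ 2 : ℕ) : ℝ) := by
                rw [Real.sqrt_sq (Nat.cast_nonneg δ)]
            _ = Real.sqrt ((δ : ℝ) ^ 2 * ((γ * δ ^ 2 : ℕ) : ℝ)) := (Real.sqrt_mul (by positivity) _).symm
            _ ≤ Real.sqrt (((γ * δ ^ 2 : ℕ) : ℝ) * ((γ * δ ^ 2 : ℕ) : ℝ)) :=
                Real.sqrt_le_sqrt (mul_le_mul_of_nonneg_right hδg hgpos.le)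
            _ = ((γ * δ ^ 2 : ℕ) : ℝ) := Real.sqrt_mul_self hgpos.le
        rw [div_le_iff₀ hgpos, inv_mul_eq_div, le_div_iff₀ (Real.sqrt_pos.mpr hgpos)]
        exact key
      calc (δ : ℝ) * (Real.sqrt ((D / (γ * δ ^ 2) : ℕ) : ℝ) *
            Real.sqrt (((D / (γ * δ ^ 2) : ℕ) : ℝ) + ((K / δ : ℕ) : ℝ) * ((L / (γ * δ) : ℕ) : ℝ)))
          ≤ (δ : ℝ) * (Real.sqrt ((D : ℝ) / ((γ * δ ^ 2 : ℕ) : ℝ)) *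
            Real.sqrt ((D : ℝ) / ((γ * δ ^ 2 : ℕ) : ℝ) + (K : ℝ) * L / ((γ * δ ^ 2 : ℕ) : ℝ))) := by
            gcongr
        _ = R * ((δ : ℝ) / ((γ * δ ^ 2 : ℕ) : ℝ)) := by rw [e3]; ring
        _ ≤ R * (Real.sqrt ((γ * δ ^ 2 : ℕ) : ℝ))⁻¹ := mul_le_mul_of_nonneg_left e4 hR0
    have hB : Real.sqrt (∑ k' ∈ Icc 1 (K / δ), ∑ ℓ' ∈ Icc 1 (L / (γ * δ)),
        ‖ξ (δ * k') (γ * δ * ℓ')‖ ^ 2) ≤ Real.sqrt (E (γ * δ ^ 2)) := by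
      refine Real.sqrt_le_sqrt ?_
      rw [hE]
      calc ∑ k' ∈ Icc 1 (K / δ), ∑ ℓ' ∈ Icc 1 (L / (γ * δ)), ‖ξ (δ * k') (γ * δ * ℓ')‖ ^ 2
          = ∑ k ∈ (Icc 1 K).filter (fun k => δ ∣ k),
              ∑ ℓ ∈ (Icc 1 L).filter (fun ℓ => γ * δ ∣ ℓ), ‖ξ k ℓ‖ ^ 2 := by
            rw [sum_filter_dvd_Icc hδ0]
            exact sum_congr rfl fun k' _ =>
              (sum_filter_dvd_Icc hγδ0 L (fun ℓ => ‖ξ (δ * k') ℓ‖ ^ 2)).symm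
        _ ≤ ∑ k ∈ Icc 1 K, ∑ ℓ ∈ (Icc 1 L).filter (fun ℓ => γ * δ ^ 2 ∣ ℓ ^ 2), ‖ξ k ℓ‖ ^ 2 := by
            refine (sum_le_sum_of_subset_of_nonneg (filter_subset _ _)
              (fun _ _ _ => sum_nonneg fun _ _ => by positivity)).trans
              (sum_le_sum fun k _ => sum_le_sum_of_subset_of_nonneg ?_ (fun _ _ _ => by positivity))
            intro ℓ hℓ
            rw [mem_filter] at hℓ ⊢
            refine ⟨hℓ.1, ?_⟩
            obtain ⟨t, ht⟩ := hℓ.2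
            exact ⟨γ * t ^ 2, by rw [ht]; ring⟩
    calc (δ : ℝ) * (190 * Real.sqrt 2 * C * T ^ 2 *
          (Real.sqrt ((D / (γ * δ ^ 2) : ℕ) : ℝ) *
            Real.sqrt (((D / (γ * δ ^ 2) : ℕ) : ℝ) + ((K / δ : ℕ) : ℝ) * ((L / (γ * δ) : ℕ) : ℝ))) *
          Real.sqrt (∑ k' ∈ Icc 1 (K / δ), ∑ ℓ' ∈ Icc 1 (L / (γ * δ)),
            ‖ξ (δ * k') (γ * δ * ℓ')‖ ^ 2))
        = 190 * Real.sqrt 2 * C * T ^ 2 *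
          ((δ : ℝ) * (Real.sqrt ((D / (γ * δ ^ 2) : ℕ) : ℝ) *
            Real.sqrt (((D / (γ * δ ^ 2) : ℕ) : ℝ) + ((K / δ : ℕ) : ℝ) * ((L / (γ * δ) : ℕ) : ℝ)))) *
          Real.sqrt (∑ k' ∈ Icc 1 (K / δ), ∑ ℓ' ∈ Icc 1 (L / (γ * δ)),
            ‖ξ (δ * k') (γ * δ * ℓ')‖ ^ 2) := by ring
      _ ≤ 190 * Real.sqrt 2 * C * T ^ 2 * (R * (Real.sqrt ((γ * δ ^ 2 : ℕ) : ℝ))⁻¹) *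
          Real.sqrt (E (γ * δ ^ 2)) := by gcongr
      _ = _ := by ring
  -- Step 3: summation over `g`
  have h3 : ∑ g ∈ Icc 1 D, (Real.sqrt g)⁻¹ * Real.sqrt (E g) ≤
      Real.sqrt (1 + Real.log D) * (Real.sqrt T * Real.sqrt Ξ) := by
    have hcs := Real.sum_mul_le_sqrt_mul_sqrt (Icc 1 D) (fun g => (Real.sqrt g)⁻¹)
      (fun g => Real.sqrt (E g))
    refine hcs.trans ?_
    have e1 : Real.sqrt (∑ g ∈ Icc 1 D, ((Real.sqrt g)⁻¹) ^ 2) ≤ Real.sqrt (1 + Real.log D) := by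
      -- `∑_{g ≤ D} g⁻¹ = H_D ≤ 1 + log D` (Mathlib `harmonic_le_one_add_log`)
      have hharm : ∑ g ∈ Icc 1 D, (g : ℝ)⁻¹ ≤ 1 + Real.log D := by
        have h : ∑ g ∈ Icc 1 D, (g : ℝ)⁻¹ = (harmonic D : ℝ) := by
          rw [harmonic_eq_sum_Icc]; push_cast; rfl
        rw [h]
        exact harmonic_le_one_add_log D
      refine Real.sqrt_le_sqrt (le_trans (le_of_eq ?_) hharm)
      refine sum_congr rfl fun g _ => ?_
      rw [inv_pow, Real.sq_sqrt (Nat.cast_nonneg g)]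
    have e2 : Real.sqrt (∑ g ∈ Icc 1 D, Real.sqrt (E g) ^ 2) ≤ Real.sqrt T * Real.sqrt Ξ := by
      rw [← Real.sqrt_mul (Nat.cast_nonneg T)]
      refine Real.sqrt_le_sqrt ?_
      simp_rw [Real.sq_sqrt (hE0 _)]
      -- `∑_g E g ≤ T Ξ`
      have hcount : ∀ ℓ ∈ Icc 1 L, (#((Icc 1 D).filter (fun g => g ∣ ℓ ^ 2)) : ℝ) ≤ T := by
        intro ℓ hℓ
        rw [mem_Icc] at hℓ
        have hℓ0 : ℓ ^ 2 ≠ 0 := pow_ne_zero 2 (by omega)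
        have hle : ℓ ^ 2 ≤ N₀ := by
          rw [hN₀, sq]
          calc ℓ * ℓ = 1 * 1 * ℓ * ℓ := by ring
            _ ≤ D * K * L * L := by gcongr <;> omega
        exact_mod_cast (card_filter_dvd_le_card_divisors D hℓ0).trans (hT _ hℓ0 hle)
      calc ∑ g ∈ Icc 1 D, E g
          = ∑ g ∈ Icc 1 D, ∑ k ∈ Icc 1 K, ∑ ℓ ∈ Icc 1 L,
              (if g ∣ ℓ ^ 2 then ‖ξ k ℓ‖ ^ 2 else 0) := by
            refine sum_congr rfl fun g _ => ?_
            rw [hE]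
            exact sum_congr rfl fun k _ => sum_filter _ _
        _ = ∑ k ∈ Icc 1 K, ∑ ℓ ∈ Icc 1 L, ∑ g ∈ Icc 1 D,
              (if g ∣ ℓ ^ 2 then ‖ξ k ℓ‖ ^ 2 else 0) := by
            rw [sum_comm]
            exact sum_congr rfl fun k _ => sum_comm
        _ = ∑ k ∈ Icc 1 K, ∑ ℓ ∈ Icc 1 L,
              (#((Icc 1 D).filter (fun g => g ∣ ℓ ^ 2)) : ℝ) * ‖ξ k ℓ‖ ^ 2 := by
            refine sum_congr rfl fun k _ => sum_congr rfl fun ℓ _ => ?_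
            rw [← sum_filter, sum_const, nsmul_eq_mul]
        _ ≤ ∑ k ∈ Icc 1 K, ∑ ℓ ∈ Icc 1 L, (T : ℝ) * ‖ξ k ℓ‖ ^ 2 := by
            refine sum_le_sum fun k _ => sum_le_sum fun ℓ hℓ => ?_
            exact mul_le_mul_of_nonneg_right (hcount ℓ hℓ) (by positivity)
        _ = T * Ξ := by
            rw [hΞ, mul_sum]
            exact sum_congr rfl fun k _ => (mul_sum _ _ _).symm
    exact mul_le_mul e1 e2 (Real.sqrt_nonneg _) (Real.sqrt_nonneg _)
  -- constants: `190 √2 ≤ 270`, `T² √T ≤ T³`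
  have hsqrt2 : Real.sqrt 2 ≤ 1.42 := by
    calc Real.sqrt 2 ≤ Real.sqrt (1.42 ^ 2) := Real.sqrt_le_sqrt (by norm_num)
      _ = 1.42 := Real.sqrt_sq (by norm_num)
  have hsqrtT : Real.sqrt T ≤ T := by
    calc Real.sqrt T ≤ Real.sqrt ((T : ℝ) ^ 2) := Real.sqrt_le_sqrt (by nlinarith)
      _ = T := Real.sqrt_sq (by positivity)
  calc ∑ d ∈ Icc 1 D, ‖∑ k ∈ Icc 1 K, ∑ ℓ ∈ Icc 1 L, ξ k ℓ * fiWeyl k ℓ d‖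
      ≤ ∑ g ∈ Icc 1 D, ∑ d' ∈ Icc 1 (D / g),
          ‖∑ ℓ ∈ (Icc 1 L).filter (fun ℓ => Nat.gcd (g * d') (ℓ ^ 2) = g),
            ∑ k ∈ Icc 1 K, ξ k ℓ * fiWeyl k ℓ (g * d')‖ := h1
    _ ≤ ∑ g ∈ Icc 1 D, 190 * Real.sqrt 2 * C * T ^ 2 * R * ((Real.sqrt g)⁻¹ * Real.sqrt (E g)) :=
        sum_le_sum h2
    _ = 190 * Real.sqrt 2 * C * T ^ 2 * R * ∑ g ∈ Icc 1 D, (Real.sqrt g)⁻¹ * Real.sqrt (E g) := by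
        rw [mul_sum]
    _ ≤ 190 * Real.sqrt 2 * C * T ^ 2 * R * (Real.sqrt (1 + Real.log D) * (Real.sqrt T * Real.sqrt Ξ)) :=
        mul_le_mul_of_nonneg_left h3 (by positivity)
    _ = (190 * Real.sqrt 2) * C * (T ^ 2 * Real.sqrt T) * Real.sqrt (1 + Real.log D) * R * Real.sqrt Ξ := by
        ring
    _ ≤ 270 * C * T ^ 3 * Real.sqrt (1 + Real.log D) * R * Real.sqrt Ξ := by
        have h270 : 190 * Real.sqrt 2 ≤ 270 := by nlinarith [Real.sqrt_nonneg 2]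
        have hT3 : (T : ℝ) ^ 2 * Real.sqrt T ≤ (T : ℝ) ^ 3 := by
          calc (T : ℝ) ^ 2 * Real.sqrt T ≤ (T : ℝ) ^ 2 * T := by gcongr
            _ = (T : ℝ) ^ 3 := by ring
        have : 0 ≤ Real.sqrt (1 + Real.log D) := Real.sqrt_nonneg _
        gcongr

/-- `√D √(D + KL) ≤ D + √(DKL)`. [folklore] -/
theorem sqrt_mul_sqrt_add_le (D M : ℝ) (hD : 0 ≤ D) (hM : 0 ≤ M) :
    Real.sqrt D * Real.sqrt (D + M) ≤ D + Real.sqrt (D * M) := by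
  have h1 : Real.sqrt (D + M) ≤ Real.sqrt D + Real.sqrt M := by
    calc Real.sqrt (D + M) ≤ Real.sqrt ((Real.sqrt D + Real.sqrt M) ^ 2) := by
          refine Real.sqrt_le_sqrt ?_
          nlinarith [Real.sq_sqrt hD, Real.sq_sqrt hM, Real.sqrt_nonneg D, Real.sqrt_nonneg M]
      _ = Real.sqrt D + Real.sqrt M := Real.sqrt_sq (by positivity)
  calc Real.sqrt D * Real.sqrt (D + M) ≤ Real.sqrt D * (Real.sqrt D + Real.sqrt M) :=
        mul_le_mul_of_nonneg_left h1 (Real.sqrt_nonneg D)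
    _ = D + Real.sqrt (D * M) := by
        rw [mul_add, Real.mul_self_sqrt hD, Real.sqrt_mul hD]

/-- **FI Lemma 3.3, PROVED** (as printed, the divisor-function losses absorbed into `(DKL)^ε`):
for every `ε > 0` there is `c = c(ε)` such that for all `D, K, L` and all complex `ξ(k, ℓ)`,
`∑_{d ≤ D} |∑_{0 < k ≤ K} ∑_{0 < ℓ ≤ L} ξ(k, ℓ) ρ(k, ℓ; d)| ≤ c (DKL)^ε (D + √(DKL)) ‖ξ‖`,
`‖ξ‖² = ∑ |ξ(k,ℓ)|²` ("`≪ (D + √(DKL))(DKL)^ε ‖ξ‖` … the implied constant depends only on `ε`").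
From `fi_lemma33_core` with the divisor bound `τ(n) ≤ C₁ n^{ε/8}` (`exists_card_divisors_le_mul_rpow`),
`log D ≤ D^{ε/8}/(ε/8)` and `√D√(D+KL) ≤ D + √(DKL)`.
[cite: FriedlanderIwaniecAnnals1998, Lemma 3.3] -/
theorem fi_lemma33 {ε : ℝ} (hε : 0 < ε) :
    ∃ c : ℝ, 0 < c ∧ ∀ (D K L : ℕ) (ξ : ℕ → ℕ → ℂ),
      ∑ d ∈ Icc 1 D, ‖∑ k ∈ Icc 1 K, ∑ ℓ ∈ Icc 1 L, ξ k ℓ * fiWeyl k ℓ d‖ ≤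
        c * ((D : ℝ) * K * L) ^ ε * ((D : ℝ) + Real.sqrt ((D : ℝ) * K * L)) *
          Real.sqrt (∑ k ∈ Icc 1 K, ∑ ℓ ∈ Icc 1 L, ‖ξ k ℓ‖ ^ 2) := by
  obtain ⟨C, hC1, hC⟩ := exists_fiRho_le_mul_card_divisors
  set ε₁ : ℝ := ε / 8 with hε₁
  have hε₁0 : 0 < ε₁ := by positivity
  obtain ⟨C₁, hC₁1, hC₁⟩ := exists_card_divisors_le_mul_rpow hε₁0
  have hC₁0 : 0 < C₁ := by linarith
  refine ⟨270 * C * (8 * C₁ ^ 3) * (1 + 1 / ε₁), by positivity, fun D K L ξ => ?_⟩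
  set Ξ : ℝ := ∑ k ∈ Icc 1 K, ∑ ℓ ∈ Icc 1 L, ‖ξ k ℓ‖ ^ 2 with hΞ
  -- degenerate cases: the left side vanishes
  have hRHS : 0 ≤ 270 * C * (8 * C₁ ^ 3) * (1 + 1 / ε₁) * ((D : ℝ) * K * L) ^ ε *
      ((D : ℝ) + Real.sqrt ((D : ℝ) * K * L)) * Real.sqrt Ξ := by positivity
  rcases Nat.eq_zero_or_pos K with rfl | hK
  · simp; positivity
  rcases Nat.eq_zero_or_pos L with rfl | hL
  · simp; positivity
  rcases Nat.eq_zero_or_pos D with rfl | hD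
  · simp
  -- the parameters
  set N₀ := D * K * L * L with hN₀
  set X : ℝ := (D : ℝ) * K * L with hX
  have hD1 : (1 : ℝ) ≤ D := by exact_mod_cast hD
  have hK1 : (1 : ℝ) ≤ K := by exact_mod_cast hK
  have hL1 : (1 : ℝ) ≤ L := by exact_mod_cast hL
  have hX1 : 1 ≤ X := by
    rw [hX]
    calc (1 : ℝ) = 1 * 1 * 1 := by ring
      _ ≤ D * K * L := by gcongr
  have hX0 : 0 < X := by linarith
  have hDX : (D : ℝ) ≤ X := by
    rw [hX]
    calc (D : ℝ) = D * 1 * 1 := by ring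
      _ ≤ D * K * L := by gcongr
  have hN₀X : (N₀ : ℝ) ≤ X ^ (2 : ℝ) := by
    rw [Real.rpow_two, hN₀, hX]
    push_cast
    have hLX : (L : ℝ) ≤ (D : ℝ) * K * L := by
      calc (L : ℝ) = 1 * 1 * L := by ring
        _ ≤ D * K * L := by gcongr
    calc (D : ℝ) * K * L * L = ((D : ℝ) * K * L) * L := by ring
      _ ≤ ((D : ℝ) * K * L) * ((D : ℝ) * K * L) :=
          mul_le_mul_of_nonneg_left hLX (by positivity)
      _ = _ := by ring
  set T : ℕ := ⌈C₁ * (N₀ : ℝ) ^ ε₁⌉₊ with hT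
  have hTτ : ∀ n, n ≠ 0 → n ≤ N₀ → #n.divisors ≤ T := by
    intro n hn0 hn
    have h1 : (#n.divisors : ℝ) ≤ C₁ * (n : ℝ) ^ ε₁ := hC₁ n hn0
    have h2 : (n : ℝ) ^ ε₁ ≤ (N₀ : ℝ) ^ ε₁ :=
      Real.rpow_le_rpow (Nat.cast_nonneg n) (by exact_mod_cast hn) hε₁0.le
    have h3 : (#n.divisors : ℝ) ≤ T :=
      (h1.trans (mul_le_mul_of_nonneg_left h2 hC₁0.le)).trans (Nat.le_ceil _)
    exact_mod_cast h3
  have hcore := fi_lemma33_core hC D K L hTτ ξ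
  refine hcore.trans ?_
  -- the factor `T³`
  have hXε : ∀ e : ℝ, 0 ≤ e → 1 ≤ X ^ e := fun e he => Real.one_le_rpow hX1 he
  have hTle : (T : ℝ) ≤ 2 * C₁ * X ^ (2 * ε₁) := by
    have h1 : (T : ℝ) < C₁ * (N₀ : ℝ) ^ ε₁ + 1 := Nat.ceil_lt_add_one (by positivity)
    have h2 : (N₀ : ℝ) ^ ε₁ ≤ X ^ (2 * ε₁) := by
      rw [Real.rpow_mul hX0.le]
      exact Real.rpow_le_rpow (Nat.cast_nonneg _) hN₀X hε₁0.le
    have h3 : 1 ≤ C₁ * X ^ (2 * ε₁) := by nlinarith [hXε (2 * ε₁) (by positivity)]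
    nlinarith
  have h6 : (X ^ (2 * ε₁)) ^ (3 : ℕ) = X ^ (6 * ε₁) := by
    rw [← Real.rpow_natCast, ← Real.rpow_mul hX0.le]
    congr 1
    push_cast
    ring
  have hT3 : (T : ℝ) ^ 3 ≤ 8 * C₁ ^ 3 * X ^ (6 * ε₁) := by
    calc (T : ℝ) ^ 3 ≤ (2 * C₁ * X ^ (2 * ε₁)) ^ 3 := by gcongr
      _ = 8 * C₁ ^ 3 * (X ^ (2 * ε₁)) ^ (3 : ℕ) := by ring
      _ = 8 * C₁ ^ 3 * X ^ (6 * ε₁) := by rw [h6]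
  -- the factor `√(1 + log D)`
  have hlog : Real.sqrt (1 + Real.log D) ≤ (1 + 1 / ε₁) * X ^ ε₁ := by
    have hlogD : 0 ≤ Real.log D := Real.log_nonneg hD1
    have h1 : Real.sqrt (1 + Real.log D) ≤ 1 + Real.log D := by
      calc Real.sqrt (1 + Real.log D) ≤ Real.sqrt ((1 + Real.log D) ^ 2) :=
            Real.sqrt_le_sqrt (by nlinarith)
        _ = 1 + Real.log D := Real.sqrt_sq (by linarith)
    have h2 : Real.log D ≤ X ^ ε₁ / ε₁ :=
      (Real.log_le_rpow_div (by positivity) hε₁0).trans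
        (div_le_div_of_nonneg_right (Real.rpow_le_rpow (by positivity) hDX hε₁0.le) hε₁0.le)
    have h3 : 1 ≤ X ^ ε₁ := hXε ε₁ hε₁0.le
    calc Real.sqrt (1 + Real.log D) ≤ 1 + Real.log D := h1
      _ ≤ X ^ ε₁ + X ^ ε₁ / ε₁ := add_le_add h3 h2
      _ = (1 + 1 / ε₁) * X ^ ε₁ := by ring
  -- the factor `√D √(D + KL)`
  have hR : Real.sqrt D * Real.sqrt (D + K * L) ≤ (D : ℝ) + Real.sqrt X := by
    have := sqrt_mul_sqrt_add_le (D : ℝ) ((K : ℝ) * L) (by positivity) (by positivity)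
    rwa [show (D : ℝ) * ((K : ℝ) * L) = X by rw [hX]; ring] at this
  -- exponents
  have hexp : X ^ (6 * ε₁) * X ^ ε₁ ≤ X ^ ε := by
    rw [← Real.rpow_add hX0]
    refine Real.rpow_le_rpow_of_exponent_le hX1 ?_
    rw [hε₁]
    linarith
  have hΞ0 : 0 ≤ Real.sqrt Ξ := Real.sqrt_nonneg _
  calc 270 * C * (T : ℝ) ^ 3 * Real.sqrt (1 + Real.log D) *
        (Real.sqrt D * Real.sqrt (D + K * L)) * Real.sqrt Ξ
      ≤ 270 * C * (8 * C₁ ^ 3 * X ^ (6 * ε₁)) * ((1 + 1 / ε₁) * X ^ ε₁) *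
        ((D : ℝ) + Real.sqrt X) * Real.sqrt Ξ := by gcongr
    _ = 270 * C * (8 * C₁ ^ 3) * (1 + 1 / ε₁) * (X ^ (6 * ε₁) * X ^ ε₁) *
        ((D : ℝ) + Real.sqrt X) * Real.sqrt Ξ := by ring
    _ ≤ 270 * C * (8 * C₁ ^ 3) * (1 + 1 / ε₁) * X ^ ε * ((D : ℝ) + Real.sqrt X) * Real.sqrt Ξ := by
        gcongr

end Literature.NumberTheory.Sieve.FriedlanderIwaniecPrimes
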